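import Mathlib

/-!
# SoloBlind E51 — an additive map that is multiplicative on a ℤ-spanning set is a ring homomorphism

Solo programme `solo-Langlands-blind`, own line (O1b), s118 (tower theory §13.9, claim C434: correctness of the q-expansion
depth engine e7).  The Hecke ring `T` is ℤ-spanned by the operators `T_n` (products of `T_n`'s are ℤ-combinations of `T_n`'s),
and an Eisenstein eigenvalue system `n ↦ σ(n)` satisfies the same multiplication table.  The step "an additive functional
`φ : T → ℤ/y^k` with `φ(T_n) = σ(n)` is automatically a ring homomorphism" is the following piece of algebra: if `φ : R →+ A` is
additive, `S ⊆ R` spans `R` over `ℤ`, and `φ (s * t) = φ s * φ t` for `s, t ∈ S`, then `φ` is multiplicative on all of `R`;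
with `φ 1 = 1` it is a ring homomorphism (`spanRingHom`).
-/

set_option linter.dupNamespace false

namespace Summit.Langlands.Langlands.Theorems.SoloBlindSpanHom

variable {R A : Type*} [Ring R] [Ring A]

/-- Right multiplication by a fixed `t ∈ S` commutes with `φ` on the ℤ-span of `S`. -/
theorem map_mul_right (φ : R →+ A) (S : Set R)
    (hmul : ∀ s ∈ S, ∀ t ∈ S, φ (s * t) = φ s * φ t) (t : R) (ht : t ∈ S)
    (x : R) (hx : x ∈ Submodule.span ℤ S) : φ (x * t) = φ x * φ t := by
  induction hx using Submodule.span_induction with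
  | mem s hs => exact hmul s hs t ht
  | zero => simp
  | add x y _ _ hx hy => rw [add_mul, map_add, map_add, hx, hy, add_mul]
  | smul a x _ hx => rw [smul_mul_assoc, map_zsmul, map_zsmul, hx, smul_mul_assoc]

/-- MULTIPLICATIVITY FROM A SPANNING SET: if `S` spans `R` over `ℤ` and the additive map `φ` is multiplicative on `S`,
then `φ` is multiplicative on `R`. -/
theorem map_mul_of_span (φ : R →+ A) (S : Set R) (hS : Submodule.span ℤ S = ⊤)
    (hmul : ∀ s ∈ S, ∀ t ∈ S, φ (s * t) = φ s * φ t) (x y : R) : φ (x * y) = φ x * φ y := by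
  have hx : x ∈ Submodule.span ℤ S := by rw [hS]; exact Submodule.mem_top
  have hy : y ∈ Submodule.span ℤ S := by rw [hS]; exact Submodule.mem_top
  induction hy using Submodule.span_induction with
  | mem t ht => exact map_mul_right φ S hmul t ht x hx
  | zero => simp
  | add y z _ _ hy hz => rw [mul_add, map_add, map_add, hy, hz, mul_add]
  | smul a y _ hy => rw [mul_smul_comm, map_zsmul, map_zsmul, hy, mul_smul_comm]

/-- The ring homomorphism determined by an additive, unital map that is multiplicative on a ℤ-spanning set. -/
def spanRingHom (φ : R →+ A) (S : Set R) (hS : Submodule.span ℤ S = ⊤)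
    (hmul : ∀ s ∈ S, ∀ t ∈ S, φ (s * t) = φ s * φ t) (h1 : φ 1 = 1) : R →+* A :=
  { φ with
    map_one' := h1
    map_mul' := map_mul_of_span φ S hS hmul }

/-- `spanRingHom` agrees with `φ` pointwise. -/
theorem spanRingHom_apply (φ : R →+ A) (S : Set R) (hS : Submodule.span ℤ S = ⊤)
    (hmul : ∀ s ∈ S, ∀ t ∈ S, φ (s * t) = φ s * φ t) (h1 : φ 1 = 1) (x : R) :
    spanRingHom φ S hS hmul h1 x = φ x := rfl

/-- Consequently the kernel of `φ` is a two-sided ideal's carrier: it is closed under left multiplication. -/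
theorem ker_mul_mem (φ : R →+ A) (S : Set R) (hS : Submodule.span ℤ S = ⊤)
    (hmul : ∀ s ∈ S, ∀ t ∈ S, φ (s * t) = φ s * φ t) (r x : R) (hx : φ x = 0) : φ (r * x) = 0 := by
  rw [map_mul_of_span φ S hS hmul, hx, mul_zero]

end Summit.Langlands.Langlands.Theorems.SoloBlindSpanHom
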